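import Literature.AlgebraicGeometry.Motives.SeesawChartSections
import Literature.AlgebraicGeometry.Modules.PullbackAffineChart
import Literature.AlgebraicGeometry.Modules.FrameTransition
import Literature.AlgebraicGeometry.Modules.RankOneCocycle
import Literature.AlgebraicGeometry.Modules.QuasicoherentAbelian
import Literature.AlgebraicGeometry.Modules.LineBundleUnitPairing
import Mathlib.RingTheory.LocalProperties.Basic
import Mathlib.RingTheory.Ideal.Quotient.Operations
import Mathlib.RingTheory.Localization.Away.Basic
import HarnessLib

/-!
# The seesaw closed subscheme, chart step: trivialised test algebras and the represented section functors

[MumfordAV1970] §10 (p. 89) / [GortzWedhorn2023] Thm. 24.66, for the chart vocabulary of `SeesawChartSections`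
(`X/ℂ` proper and geometrically integral, `W/ℂ`, `𝓕` on `X × W`, affine `U ⊆ W` with ring `A = Γ(W, U)`):
* §1 the two REPRESENTABILITY predicates on the chart `D(f) ⊆ U`: `H0ReprChart X 𝓕 U f I` («`B ↦ H⁰(X_B, 𝓕_B)` is
  naturally `B ↦ Ann_B(I·B)`, `B`-linearly, on the `A`-algebras in which `f` is a unit», [MumfordAV1970] §5 Theorem p. 46 in
  the cyclic case) and its dual `DualReprChart X 𝓕 U h𝓕 f I′` for `Hom(𝓕_B|_⊤, 𝒪|_⊤)`;
* §2 (T-H1′) `exists_h0_linearEquiv_of_triv`: if `𝓕_B` is trivialised from the base then near every maximal ideal of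
  `B`, `H⁰(X_{B_g}, 𝓕_{B_g}) ≃ₗ[B_g] B_g` (a global frame after localising; `Γ(X × Spec B_g, 𝒪) = B_g`);
* §4 the basic opens `awayOpen g = D(g) ⊆ Spec B` and `isOpenImmersion_awayTestMap` (plumbing for Zariski locality);
* §3 (T-H2′) `triv_of_map_eq_bot`: if both functors are so represented and `I·B = 0 = I′·B`, then `𝓕_B` is trivialised
  from the base — the universal sections `σ`, `μ` pair to a function `μ(σ) ∈ Γ(X_B, 𝒪) = B` that is non-zero in every
  residue field (★ `appLE_ne_zero_of_ne_zero` on the integral fibres `X × Spec(B/𝔪)`, transported by the base-change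
  identity `brickN`), hence a unit, hence `𝓕_B ≅ 𝒪` (★ `nonempty_iso_unit_of_section_dualSection`).
(Cell `hodgecm-mathlib`, M13 node N1, file S5a of the split plan; HOME certificate `B-plan/m13-glue/N1-Assembly.v9.B-p01g12.lean`
164baf9abb46c288 PART II §4–§5, §8 — decls token-identical except that the hypotheses `brickA`/`brickB` of v9 are
discharged here by the ★ names.)

## References
* [MumfordAV1970] D. Mumford, *Abelian Varieties* (1970), §5 Theorem (p. 46), §10 p. 89.
* [GortzWedhorn2023] U. Görtz, T. Wedhorn, *Algebraic Geometry II* (2023), Prop. 23.147; Thm. 24.66 (p. 405; proof pp. 407–408).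
* [Hartshorne1977] R. Hartshorne, *Algebraic Geometry* (1977), II Prop. 6.15, II Ex. 6.11.
-/

set_option autoImplicit false

noncomputable section

-- `TopCat.Presheaf`/`Scheme.Modules` are not reducible (as in Mathlib's `AlgebraicGeometry/Modules`).
set_option backward.isDefEq.respectTransparency false

universe u

open CategoryTheory CategoryTheory.Limits AlgebraicGeometry MonoidalCategory CartesianMonoidalCategory
  Opposite

namespace Literature.AlgebraicGeometry.Motives

namespace SeesawSubscheme

open Literature.AlgebraicGeometry.Modules

variable (X : SchemeOver ℂ) {W : SchemeOver ℂ} (𝓕 : (X ⊗ W).left.Modules) (U : W.left.affineOpens)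

/-! ## §1 The two representability predicates on a chart `D(f) ⊆ U` -/


/-- **`H0ReprChart X 𝓕 U f I`** — on the chart `D(f) ⊆ U`, `H⁰(X × Spec B, 𝓕_B) ≃ₗ[B] Ann_B(I·B)` NATURALLY for the
`Γ(W, U)`-algebras `B` in which `f` is a unit ([MumfordAV1970] §5 Theorem p. 46 in the cyclic case produced by Nakayama
near a point of the seesaw locus, §10 p. 89): `B`-LINEAR isomorphisms `ρ_B` natural along algebra maps,
`ρ_C (H⁰(φ) s) = φ (ρ_B s)`. [cite: MumfordAV1970, §5 Theorem (p. 46) and §10 (p. 89)]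
[cite: GortzWedhorn2023, Prop. 23.147; Thm. 24.66 (p. 405; proof pp. 407–408)] -/
def H0ReprChart (f : Γ(W.left, U)) (I : Ideal Γ(W.left, U)) : Prop :=
  ∃ ρ : ∀ (B : Type) [CommRing B] [Algebra Γ(W.left, U) B], IsUnit (algebraMap Γ(W.left, U) B f) →
      (H0 X 𝓕 U B ≃ₗ[B] (I.map (algebraMap Γ(W.left, U) B)).annihilator),
    ∀ (B C : Type) [CommRing B] [Algebra Γ(W.left, U) B] [CommRing C] [Algebra Γ(W.left, U) C]
      (hB : IsUnit (algebraMap Γ(W.left, U) B f)) (hC : IsUnit (algebraMap Γ(W.left, U) C f))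
      (φ : B →ₐ[Γ(W.left, U)] C) (s : H0 X 𝓕 U B),
      ((ρ C hC (H0map X 𝓕 U φ s) : C) : C) = φ (ρ B hB s : B)

/-- **`DualReprChart X 𝓕 U h𝓕 f I′`** — the same for the dual sections: `Hom(𝓕_B|_⊤, 𝒪|_⊤) ≃ₗ[B] Ann_B(I′·B)`
naturally on the `Γ(W, U)`-algebras in which `f` is a unit (the representability of `B ↦ H⁰(X_B, 𝓕_B⁻¹)` on the chart,
[MumfordAV1970] §5 Theorem / §10 p. 89 for `L⁻¹`). [cite: MumfordAV1970, §5 Theorem (p. 46) and §10 (p. 89)] -/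
def DualReprChart (h𝓕 : HasRank 𝓕 1) (f : Γ(W.left, U)) (I' : Ideal Γ(W.left, U)) : Prop :=
  ∃ ρ' : ∀ (B : Type) [CommRing B] [Algebra Γ(W.left, U) B], IsUnit (algebraMap Γ(W.left, U) B f) →
      (DualSec X 𝓕 U B ≃ₗ[B] (I'.map (algebraMap Γ(W.left, U) B)).annihilator),
    ∀ (B C : Type) [CommRing B] [Algebra Γ(W.left, U) B] [CommRing C] [Algebra Γ(W.left, U) C]
      (hB : IsUnit (algebraMap Γ(W.left, U) B f)) (hC : IsUnit (algebraMap Γ(W.left, U) C f))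
      (φ : B →ₐ[Γ(W.left, U)] C) (μ : DualSec X 𝓕 U B),
      ((ρ' C hC (DualSecMap X 𝓕 U h𝓕 φ μ) : C) : C) = φ (ρ' B hB μ : B)

/-! ## §2 (T-H1′): a trivialised `B` has `H⁰(X_{B_g}, 𝓕_{B_g}) ≃ₗ[B_g] B_g` near every maximal ideal -/

section GlobalFrame

variable {Y : Scheme.{0}} {E : Y.Modules} {I : Type} [Fintype I] [Unique I]

/-- **Sections of a module with a GLOBAL frame of rank one are the global functions**, linearly:
`s ↦` its coordinate, `c ↦ c · b` (non-Prop plumbing). [folklore] -/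
def sectionsEquivOfGlobalFrame (e : SheafOfModules.free I ≅ E.over (⊤ : Y.Opens)) :
    Γ(E, (⊤ : Y.Opens)) ≃ₗ[Γ(Y, (⊤ : Y.Opens))] Γ(Y, (⊤ : Y.Opens)) where
  toFun s := coord e (𝟙 ⊤) s default
  invFun c := c • basisSection e default
  map_add' s t := coord_add e (𝟙 ⊤) s t default
  map_smul' r s := coord_smul e (𝟙 ⊤) r s default
  left_inv s := by
    have h := eq_sum_coord_smul e (𝟙 ⊤) s
    rw [Fintype.sum_unique, op_id, E.presheaf.map_id] at h
    exact h.symm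
  right_inv c := by
    change coord e (𝟙 ⊤) (c • basisSection e default) default = c
    rw [coord_smul, coord_basisSection, if_pos rfl, mul_one]

end GlobalFrame

/-- **`H⁰(X_B, 𝓕_B) ≃ₗ[B] Γ(X_B, 𝒪)`-transport**: a `Γ(X_B, 𝒪)`-linear equivalence `Γ(𝓕_B) ≃ Γ(𝒪)`
composed with a ring isomorphism `τ : B ≃ Γ(X_B, 𝒪)` equal to the structure map is `B`-linear
(non-Prop plumbing). [folklore] -/
def h0LinearEquivOfSections (B : Type) [CommRing B] [Algebra Γ(W.left, U) B]
    (ε : H0 X 𝓕 U B ≃ₗ[Γ((X ⊗ specTest U B).left, (⊤ : (X ⊗ specTest U B).left.Opens))]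
      Γ((X ⊗ specTest U B).left, (⊤ : (X ⊗ specTest U B).left.Opens)))
    (τ : B ≃+* Γ((X ⊗ specTest U B).left, (⊤ : (X ⊗ specTest U B).left.Opens)))
    (hτ : ∀ b, τ b = toTopRing X U B b) : H0 X 𝓕 U B ≃ₗ[B] B where
  toFun s := τ.symm (ε s)
  invFun c := ε.symm (τ c)
  map_add' s t := by rw [map_add, map_add]
  map_smul' c s := by
    rw [smul_H0_def, LinearEquiv.map_smul, smul_eq_mul, map_mul, RingHom.id_apply, smul_eq_mul, ← hτ,
      RingEquiv.symm_apply_apply]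
  left_inv s := by
    change ε.symm (τ (τ.symm (ε s))) = s
    rw [RingEquiv.apply_symm_apply, LinearEquiv.symm_apply_apply]
  right_inv c := by
    change τ.symm (ε (ε.symm (τ c))) = c
    rw [LinearEquiv.apply_symm_apply, RingEquiv.symm_apply_apply]

section TrivChart

variable {X 𝓕 U}
variable {B : Type} [CommRing B] [Algebra Γ(W.left, U) B]

/-- The test morphism of `B_g` over that of `B` (non-Prop plumbing). [folklore] -/
abbrev awayTestMap (U : W.left.affineOpens) {B : Type} [CommRing B] [Algebra Γ(W.left, U) B] (g : B) :
    specTest U (Localization.Away g) ⟶ specTest U B :=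
  specTestMap U (IsScalarTower.toAlgHom Γ(W.left, U) B (Localization.Away g))

/-- `Spec B_g → Spec B` lands in `D(g)`. [cite: MumfordAV1970, §10 (p. 89)] -/
theorem awayTestMap_apply_mem (g : B) (p : (specTest U (Localization.Away g)).left) :
    (awayTestMap U g).left.base p ∈ PrimeSpectrum.basicOpen (R := B) g := by
  change PrimeSpectrum.comap (algebraMap B (Localization.Away g)) p ∈ PrimeSpectrum.basicOpen g
  rw [PrimeSpectrum.mem_basicOpen, PrimeSpectrum.comap_asIdeal, Ideal.mem_comap]
  exact fun h => p.2.ne_top (Ideal.eq_top_of_isUnit_mem _ h (IsLocalization.Away.algebraMap_isUnit g))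

/-- `Spec B_g → Spec B` lands in every open containing `D(g)`. [cite: MumfordAV1970, §10 (p. 89)] -/
theorem awayTestMap_preimage_eq_top (g : B) {V : (specTest U B).left.Opens}
    (hV : ∀ p : (specTest U B).left, p ∈ PrimeSpectrum.basicOpen (R := B) g → p ∈ V) :
    (awayTestMap U g).left ⁻¹ᵁ V = ⊤ :=
  top_le_iff.mp fun p _ => hV _ (awayTestMap_apply_mem g p)

/-- `X × Spec B_g → Spec B` (non-Prop plumbing). [folklore] -/
abbrev awayProj (X : SchemeOver ℂ) (U : W.left.affineOpens) {B : Type} [CommRing B]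
    [Algebra Γ(W.left, U) B] (g : B) :
    (X ⊗ specTest U (Localization.Away g)).left ⟶ (specTest U B).left :=
  (CartesianMonoidalCategory.snd X (specTest U (Localization.Away g))).left ≫ (awayTestMap U g).left

/-- `(1 × Spec(B → B_g)) ≫ pr_{Spec B}` is the projection `X × Spec B_g → Spec B`. [cite: MumfordAV1970, §10 (p. 89)] -/
theorem whiskerLeft_awayTestMap_snd (g : B) :
    (X ◁ awayTestMap U g).left ≫ (CartesianMonoidalCategory.snd X (specTest U B)).left = awayProj X U g := by
  rw [← Over.comp_left, CartesianMonoidalCategory.whiskerLeft_snd]; rfl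

/-- `𝓕_{B_g} ≅ (X × Spec B_g → Spec B)^* 𝓜` when `𝓕_B ≅ pr^*𝓜` (non-Prop plumbing). [folklore] -/
def FBAwayIso (g : B) {𝓜 : (specTest U B).left.Modules}
    (e : FB X 𝓕 U B ≅ (Scheme.Modules.pullback (CartesianMonoidalCategory.snd X (specTest U B)).left).obj 𝓜) :
    FB X 𝓕 U (Localization.Away g) ≅ (Scheme.Modules.pullback (awayProj X U g)).obj 𝓜 :=
  (FBIso X 𝓕 U (IsScalarTower.toAlgHom Γ(W.left, U) B (Localization.Away g))).symm ≪≫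
    (Scheme.Modules.pullback (X ◁ awayTestMap U g).left).mapIso e ≪≫
    (Scheme.Modules.pullbackComp (X ◁ awayTestMap U g).left
      (CartesianMonoidalCategory.snd X (specTest U B)).left).app 𝓜 ≪≫
    (Scheme.Modules.pullbackCongr (whiskerLeft_awayTestMap_snd (X := X) g)).app 𝓜

/-- `X × Spec B_g → Spec B` lands in every open containing `D(g)`. [cite: MumfordAV1970, §10 (p. 89)] -/
theorem top_le_awayProj_preimage (g : B) {V : (specTest U B).left.Opens}
    (hV : (awayTestMap U g).left ⁻¹ᵁ V = ⊤) :
    (⊤ : (X ⊗ specTest U (Localization.Away g)).left.Opens) ≤ awayProj X U g ⁻¹ᵁ V := by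
  rw [Scheme.Hom.comp_preimage, hV, Scheme.Hom.preimage_top]

/-- **The global frame of `𝓕_{B_g}`** pulled back from a frame of `𝓜` over an open `V ⊇ D(g)`
(non-Prop plumbing). [cite: MumfordAV1970, §10 (p. 89)] -/
def globalFrameAway (g : B) {𝓜 : (specTest U B).left.Modules}
    (e : FB X 𝓕 U B ≅ (Scheme.Modules.pullback (CartesianMonoidalCategory.snd X (specTest U B)).left).obj 𝓜)
    {V : (specTest U B).left.Opens} {I : Type} [Fintype I] (fr : SheafOfModules.free I ≅ 𝓜.over V)
    (hV : (awayTestMap U g).left ⁻¹ᵁ V = ⊤) :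
    SheafOfModules.free I ≅
      (FB X 𝓕 U (Localization.Away g)).over (⊤ : (X ⊗ specTest U (Localization.Away g)).left.Opens) :=
  SheafOfModules.restrictTrivialisation (homOfLE (top_le_awayProj_preimage (X := X) g hV))
      (pullbackFrame (awayProj X U g) fr) ≪≫
    (SheafOfModules.overFunctor _ ⊤).mapIso (FBAwayIso g e).symm

end TrivChart

variable [IsProper X.hom] [GeometricallyIntegral X.hom]

/-- **A global frame of rank one on `𝓕_B` gives `H⁰(X_B, 𝓕_B) ≃ₗ[B] B`.** [cite: MumfordAV1970, §10 (p. 89)] -/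
theorem nonempty_h0_linearEquiv_of_globalFrame (B : Type) [CommRing B] [Algebra Γ(W.left, U) B]
    {I : Type} [Fintype I] [Unique I]
    (e₀ : SheafOfModules.free I ≅ (FB X 𝓕 U B).over (⊤ : (X ⊗ specTest U B).left.Opens)) :
    Nonempty (H0 X 𝓕 U B ≃ₗ[B] B) :=
  ⟨h0LinearEquivOfSections X 𝓕 U B (sectionsEquivOfGlobalFrame e₀)
    (RingEquiv.ofBijective (toTopRing X U B) (toTopRing_bijective X U B)) fun _ => rfl⟩


/-- **(T-H1′)** ([MumfordAV1970] §10 p. 89: «`𝓕_B ≅ pr^*𝓜` with `𝓜` invertible, hence free near each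
point»): if `𝓕_B` is trivialised from the base then near every maximal ideal `𝔪` of `B` there is `g ∉ 𝔪`
with `H⁰(X × Spec B_g, 𝓕_{B_g}) ≃ₗ[B_g] B_g` — the rank-one `𝓜` is free on a basic open `D(g) ∋ 𝔪`, the
global frame pulls back to `X × Spec B_g`, and `Γ(X × Spec B_g, 𝒪) = B_g`. [cite: MumfordAV1970, §10 (p. 89)] -/
theorem exists_h0_linearEquiv_of_triv (B : Type) [CommRing B] [Algebra Γ(W.left, U) B]
    (hB : Triv X 𝓕 U B) (𝔪 : Ideal B) [𝔪.IsMaximal] :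
    ∃ g ∉ 𝔪, Nonempty (H0 X 𝓕 U (Localization.Away g) ≃ₗ[Localization.Away g] Localization.Away g) := by
  obtain ⟨𝓜, -, h𝓜1, ⟨e⟩⟩ := hB
  obtain ⟨F, hF⟩ := exists_frameSystem_of_hasRank h𝓜1
  -- the point of `Spec B` at `𝔪` and a basic open `D(g) ∋ 𝔪` inside the trivialising open `F.U x`
  let x : (specTest U B).left := (⟨𝔪, inferInstance⟩ : PrimeSpectrum B)
  obtain ⟨f, hfV, hxf⟩ :=
    (isAffineOpen_top (specTest U B).left).exists_basicOpen_le ⟨x, F.mem x⟩ (Set.mem_univ x)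
  have hfg : (specTest U B).left.basicOpen f =
      PrimeSpectrum.basicOpen ((Scheme.ΓSpecIso (.of B)).hom f) :=
    basicOpen_eq_of_affine' (R := .of B) f
  refine ⟨(Scheme.ΓSpecIso (.of B)).hom f, ?_, ?_⟩
  · have h : x ∈ (specTest U B).left.basicOpen f := hxf
    rw [hfg] at h
    exact h
  · haveI : Fintype (F.I x) := Fintype.ofEquiv _ ((F.enum x).trans (finCongr (hF x))).symm
    haveI : Unique (F.I x) := ((F.enum x).trans (finCongr (hF x))).unique
    exact nonempty_h0_linearEquiv_of_globalFrame X 𝓕 U (Localization.Away _)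
      (globalFrameAway (X := X) (𝓕 := 𝓕) _ e (F.frame x)
        (awayTestMap_preimage_eq_top _ fun p hp => hfV (hfg ▸ hp)))

/-! ## §3 (T-H2′): `I·B = 0 = I′·B` ⇒ `𝓕_B` is trivialised from the base -/

omit [IsProper X.hom] [GeometricallyIntegral X.hom] in
/-- The structure maps `B → Γ(X_B, 𝒪)` are natural in `B`. [cite: MumfordAV1970, §10 (p. 89)] -/
theorem baseChangeTop_toTopRing {B C : Type} [CommRing B] [Algebra Γ(W.left, U) B] [CommRing C]
    [Algebra Γ(W.left, U) C] (φ : B →ₐ[Γ(W.left, U)] C) (b : B) :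
    baseChangeTop X U φ (toTopRing X U B b) = toTopRing X U C (φ b) := by
  -- `(1 × Spec φ) ≫ pr_B = pr_C ≫ Spec φ`
  have hsq : (X ◁ specTestMap U φ).left ≫ (CartesianMonoidalCategory.snd X (specTest U B)).left =
      (CartesianMonoidalCategory.snd X (specTest U C)).left ≫ (specTestMap U φ).left := by
    rw [← Over.comp_left, ← Over.comp_left, CartesianMonoidalCategory.whiskerLeft_snd]
  have h := congrArg (fun f => (Scheme.Hom.appTop f).hom ((Scheme.ΓSpecIso (.of B)).inv b)) hsq
  simp only [Scheme.Hom.comp_appTop, CommRingCat.hom_comp, RingHom.comp_apply] at h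
  change ((X ◁ specTestMap U φ).left.appTop).hom
      (((CartesianMonoidalCategory.snd X (specTest U B)).left.appTop).hom ((Scheme.ΓSpecIso (.of B)).inv b)) =
    ((CartesianMonoidalCategory.snd X (specTest U C)).left.appTop).hom ((Scheme.ΓSpecIso (.of C)).inv (φ b))
  refine h.trans ?_
  congr 1
  exact (congrArg (fun f => f.hom b)
    (Scheme.ΓSpecIso_inv_naturality (CommRingCat.ofHom (φ : B →+* C)))).symm

omit [IsProper X.hom] [GeometricallyIntegral X.hom] in
/-- An element that is non-zero modulo every maximal ideal is a unit. [cite: MumfordAV1970, §10 (p. 89)] -/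
theorem isUnit_of_forall_maximal_mk_ne_zero {B : Type} [CommRing B] (p : B)
    (h : ∀ (𝔪 : Ideal B) [𝔪.IsMaximal], Ideal.Quotient.mk 𝔪 p ≠ 0) : IsUnit p := by
  by_contra hp
  obtain ⟨𝔪, h𝔪, hle⟩ := Ideal.exists_le_maximal (Ideal.span {p})
    (fun htop => hp (Ideal.span_singleton_eq_top.mp htop))
  exact h 𝔪 (Ideal.Quotient.eq_zero_iff_mem.mpr (hle (Ideal.subset_span rfl)))

/-- **(T-H2′)** ([MumfordAV1970] §10 p. 89: «the universal sections of `L` and `L⁻¹` over `V(I + I′)` pair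
to a unit, so `L` is trivial there»): if `H⁰(𝓕_B)` and `Hom(𝓕_B, 𝒪)` are represented by `Ann(I)`,
`Ann(I′)` on the chart and both `I`, `I′` die in `B`, then `𝓕_B` is trivialised from the base (★ bricks
(A) `nonempty_iso_unit_of_section_dualSection`, (B) `appLE_ne_zero_of_ne_zero`; the base-change identity (N) is a
hypothesis). [cite: MumfordAV1970, §10 (p. 89)] -/
theorem triv_of_map_eq_bot (h𝓕 : HasRank 𝓕 1) (hN : brickN X 𝓕 U h𝓕)
    {f : Γ(W.left, U)} {I I' : Ideal Γ(W.left, U)} (hρ : H0ReprChart X 𝓕 U f I)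
    (hρ' : DualReprChart X 𝓕 U h𝓕 f I')
    (B : Type) [CommRing B] [Algebra Γ(W.left, U) B] (hf : IsUnit (algebraMap Γ(W.left, U) B f))
    (hI : I.map (algebraMap Γ(W.left, U) B) = ⊥) (hI' : I'.map (algebraMap Γ(W.left, U) B) = ⊥) :
    Triv X 𝓕 U B := by
  obtain ⟨ρ₀, hρn⟩ := hρ
  obtain ⟨ρ'₀, hρ'n⟩ := hρ'
  let ρ := fun (C : Type) [CommRing C] [Algebra Γ(W.left, U) C] (hC : IsUnit (algebraMap Γ(W.left, U) C f)) =>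
    ρ₀ C hC
  let ρ' := fun (C : Type) [CommRing C] [Algebra Γ(W.left, U) C] (hC : IsUnit (algebraMap Γ(W.left, U) C f)) =>
    ρ'₀ C hC
  -- the universal sections
  have h1 : (1 : B) ∈ (I.map (algebraMap Γ(W.left, U) B)).annihilator := by
    rw [hI, Submodule.annihilator_bot]; trivial
  have h1' : (1 : B) ∈ (I'.map (algebraMap Γ(W.left, U) B)).annihilator := by
    rw [hI', Submodule.annihilator_bot]; trivial
  set σ : H0 X 𝓕 U B := (ρ B hf).symm ⟨1, h1⟩ with hσ
  set μ : DualSec X 𝓕 U B := (ρ' B hf).symm ⟨1, h1'⟩ with hμ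
  have hρσ : ((ρ B hf σ : _) : B) = 1 := by rw [hσ, LinearEquiv.apply_symm_apply]
  have hρμ : ((ρ' B hf μ : _) : B) = 1 := by rw [hμ, LinearEquiv.apply_symm_apply]
  -- their pairing `p = μ(σ) ∈ Γ(X_B, 𝒪) = B`
  obtain ⟨b₀, hb₀⟩ := (toTopRing_bijective X U B).2 (evalPair X 𝓕 U B μ σ)
  -- `b₀` is a unit: it is non-zero in every residue field
  have hu : IsUnit b₀ := by
    refine isUnit_of_forall_maximal_mk_ne_zero b₀ fun 𝔪 _ => ?_
    letI := Ideal.Quotient.field 𝔪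
    let φ : B →ₐ[Γ(W.left, U)] B ⧸ 𝔪 := Ideal.Quotient.mkₐ _ 𝔪
    have hfK : IsUnit (algebraMap Γ(W.left, U) (B ⧸ 𝔪) f) := by
      rw [show algebraMap Γ(W.left, U) (B ⧸ 𝔪) f = φ (algebraMap Γ(W.left, U) B f) from (φ.commutes f).symm]
      exact hf.map φ
    haveI : IsIntegral (X ⊗ specTest U (B ⧸ 𝔪)).left := isIntegral_tensor_specTest X U (B ⧸ 𝔪)
    -- the pulled-back sections are non-zero (naturality of `ρ`, `ρ′`)
    have hσK : H0map X 𝓕 U φ σ ≠ 0 := by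
      intro h0
      have h := hρn B (B ⧸ 𝔪) hf hfK φ σ
      rw [h0, map_zero, hρσ, map_one] at h
      exact zero_ne_one (h.trans rfl : ((0 : (I.map (algebraMap Γ(W.left, U) (B ⧸ 𝔪))).annihilator) : B ⧸ 𝔪) = 1)
    have hμK : DualSecMap X 𝓕 U h𝓕 φ μ ≠ 0 := by
      intro h0
      have h := hρ'n B (B ⧸ 𝔪) hf hfK φ μ
      rw [h0, map_zero, hρμ, map_one] at h
      exact zero_ne_one (h.trans rfl : ((0 : (I'.map (algebraMap Γ(W.left, U) (B ⧸ 𝔪))).annihilator) : B ⧸ 𝔪) = 1)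
    -- ★ brick (B) on the integral `X × Spec(B/𝔪)`, transported by brick (N)
    have hne := appLE_ne_zero_of_ne_zero (hasRank_FB X 𝓕 U h𝓕 (B ⧸ 𝔪)) hσK hμK
    change evalPair X 𝓕 U (B ⧸ 𝔪) (DualSecMap X 𝓕 U h𝓕 φ μ) (H0map X 𝓕 U φ σ) ≠ 0 at hne
    rw [hN B (B ⧸ 𝔪) φ σ μ, ← hb₀, baseChangeTop_toTopRing] at hne
    intro hb
    apply hne
    change toTopRing X U (B ⧸ 𝔪) (φ b₀) = 0
    rw [show φ b₀ = Ideal.Quotient.mk 𝔪 b₀ from rfl, hb, map_zero]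
  have hp : IsUnit (evalPair X 𝓕 U B μ σ) := hb₀ ▸ hu.map (toTopRing X U B)
  -- ★ brick (A): `𝓕_B ≅ 𝒪`, hence trivialised from the base with `𝓜 = 𝒪`
  obtain ⟨e₁⟩ := nonempty_iso_unit_of_section_dualSection (hasRank_FB X 𝓕 U h𝓕 B) σ μ hp
  haveI := isIso_pullbackUnitComparison (CartesianMonoidalCategory.snd X (specTest U B)).left
  haveI : (unitModule (specTest U B).left).IsQuasicoherent :=
    isQuasicoherent_of_isAffineLocalizing IsAffineLocalizing.unit
  exact ⟨unitModule (specTest U B).left, inferInstance, hasRank_unitModule,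
    ⟨e₁ ≪≫ (asIso (pullbackUnitComparison (CartesianMonoidalCategory.snd X (specTest U B)).left)).symm⟩⟩

/-! ## §4 The basic opens `D(g) ⊆ Spec B` and the open immersions `Spec B_g → Spec B` -/

section Locality

variable {B : Type} [CommRing B] [Algebra Γ(W.left, U) B]

omit 𝓕 in
/-- The basic open `D(g) ⊆ Spec B` as an open of the test scheme (non-Prop plumbing). [folklore] -/
def awayOpen (g : B) : (specTest U B).left.Opens :=
  ⟨(PrimeSpectrum.basicOpen (R := B) g : Set (PrimeSpectrum B)), (PrimeSpectrum.basicOpen g).2⟩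

omit 𝓕 in
/-- Membership in `D(g)`. [cite: MumfordAV1970, §10 (p. 89)] -/
theorem mem_awayOpen (g : B) (p : (specTest U B).left) :
    p ∈ awayOpen U g ↔ g ∉ (p : PrimeSpectrum B).asIdeal := Iff.rfl

omit 𝓕 in
/-- `Spec B_g → Spec B` (the `.left` of `awayTestMap`) is an open immersion. [cite: MumfordAV1970, §10 (p. 89)] -/
theorem isOpenImmersion_awayTestMap (g : B) : IsOpenImmersion (awayTestMap U g).left := by
  change IsOpenImmersion (Spec.map (CommRingCat.ofHom (algebraMap B (Localization.Away g))))
  infer_instance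

omit 𝓕 in
/-- The basic open `D(g) ⊆ Spec B` lies in the image of `Spec B_g`. [cite: MumfordAV1970, §10 (p. 89)] -/
theorem range_ι_awayOpen_subset (g : B) :
    Set.range (awayOpen U g).ι ⊆ Set.range (awayTestMap U g).left := by
  rw [Scheme.Opens.range_ι]
  intro p hp
  change p ∈ Set.range (PrimeSpectrum.comap (algebraMap B (Localization.Away g)))
  rw [PrimeSpectrum.localization_away_comap_range (Localization.Away g) g]
  exact hp

omit 𝓕 in
/-- `specTestι` of `B_g` factors through that of `B`. [cite: MumfordAV1970, §10 (p. 89)] -/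
theorem awayTestMap_left_comp_specTestι (g : B) :
    (awayTestMap U g).left ≫ specTestι U B = specTestι U (Localization.Away g) :=
  congrArg (fun k => Over.Hom.left k)
    (specTestMap_comp U (IsScalarTower.toAlgHom Γ(W.left, U) B (Localization.Away g)))

end Locality

end SeesawSubscheme

end Literature.AlgebraicGeometry.Motives

end
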